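import Mathlib
import Literature.Analysis.ODE.InverseSquareTailOperator

/-!
# The recessive solution `u ~ x^{-ℓ}` of `u'' = (ℓ(ℓ+1)/x² + W) u` at `+∞` for `W = O(1/(x²√x))`

Analysis/ODE support file (everything proved, no definitions), continuing
`InverseSquareTailOperator.lean`. Let `ℓ : ℕ`, `X ≥ 1`, and let `W` be continuous on `[X, ∞)` with
`|W(x)| ≤ A/(x²√x)` there and `12 A ≤ √X`. Writing `u = x^{-ℓ} v`, the equation
`u'' = (ℓ(ℓ+1)/x² + W)u` becomes `(x^{-2ℓ} v')' = x^{-2ℓ} W v`, and the solution recessive at `+∞`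
(`v → 1`) is the fixed point of the Volterra operator

  `(T v)(x) = 1 + (2ℓ+1)⁻¹ [ ∫_x^∞ y W v dy − x^{2ℓ+1} ∫_x^∞ y^{-2ℓ} W v dy ]`   (`x ≥ X`),

a contraction (constant `2/9`) of the bounded continuous functions on `ℝ` (arguments clamped to
`[X, ∞)`). Main results:
* `exists_volterra_inverseSquareTail`: a continuous `v`, `|v| ≤ 9/7`, solving the integral
  equation on `[X, ∞)`, with `|v − 1| ≤ 4A/√x`;
* `volterra_inverseSquareTail_deriv`: such a `v` is `C²` on `(X, ∞)` with
  `v' = −x^{2ℓ} ∫_x^∞ W v/y^{2ℓ}`, `|v'| ≤ 2AC/(3x√x)`, `v'' = (2ℓ/x) v' + W v`;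
* `exists_inverseSquareTail_recessive`: `u = x^{-ℓ} v` solves `u'' = (ℓ(ℓ+1)/x² + W) u` on
  `(X, ∞)` with `|x^ℓ u − 1| ≤ 4A/√x`, `|x^{ℓ+1} u' + ℓ| ≤ (4ℓ+1)A/√x`, `u > 0` on `[X, ∞)`.
This is the classical asymptotic integration with an integrable long-range perturbation
(P. Hartman, *Ordinary Differential Equations*, Ch. X §17, Ch. XI §9; folklore), in the form needed
for the static element of the far-side kernel of the Regge–Wheeler channel estimate
(route PhotonSphereChannels, `FixedModeChannels`, stmt-FinalStateConjecture-10048).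
-/

noncomputable section

namespace Literature.Analysis.ODE

open MeasureTheory Set Filter Topology BoundedContinuousFunction

/-! ### The recessive solution by the contraction principle -/

section Recessive

variable {W : ℝ → ℝ} {X A : ℝ}

/-- Product bound: `|W y · w y| ≤ A‖w‖/(y²√y)` for a bounded continuous `w`. [folklore] -/
theorem abs_mul_bcf_le (hX : 1 ≤ X) (hWA : ∀ y, X ≤ y → |W y| ≤ A / (y ^ 2 * Real.sqrt y))
    (w : ℝ →ᵇ ℝ) {y : ℝ} (hy : X ≤ y) :
    |W y * w y| ≤ A * ‖w‖ / (y ^ 2 * Real.sqrt y) := by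
  have hy0 : 0 < y := lt_of_lt_of_le one_pos (hX.trans hy)
  have hA : 0 ≤ A := nonneg_of_abs_le_div_sqrt (lt_of_lt_of_le one_pos hX) (hWA X le_rfl)
  rw [abs_mul]
  have h1 : |w y| ≤ ‖w‖ := by simpa [Real.norm_eq_abs] using w.norm_coe_le_norm y
  calc |W y| * |w y| ≤ A / (y ^ 2 * Real.sqrt y) * ‖w‖ :=
        mul_le_mul (hWA y hy) h1 (abs_nonneg _) (by positivity)
    _ = A * ‖w‖ / (y ^ 2 * Real.sqrt y) := by ring

/-- **The recessive solution, integral-equation form.** For `W` continuous on `[X, ∞)` (`X ≥ 1`) with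
`|W| ≤ A/(y²√y)` and `12A ≤ √X`, there is a continuous `v : ℝ → ℝ`, `|v| ≤ 9/7`, solving
`v(x) = 1 + (2ℓ+1)⁻¹ [∫_x^∞ y W v − x^{2ℓ+1} ∫_x^∞ W v/y^{2ℓ}]` for `x ≥ X`, with `|v(x) − 1| ≤ 4A/√x`. [folklore] -/
theorem exists_volterra_inverseSquareTail (ℓ : ℕ) (hX : 1 ≤ X) (hW : ContinuousOn W (Ici X))
    (hWA : ∀ y, X ≤ y → |W y| ≤ A / (y ^ 2 * Real.sqrt y)) (hAX : 12 * A ≤ Real.sqrt X) :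
    ∃ v : ℝ → ℝ, Continuous v ∧ (∀ x, |v x| ≤ 9 / 7)
      ∧ (∀ x, X ≤ x → v x = 1 + (2 * (ℓ : ℝ) + 1)⁻¹ * ((∫ y in Ioi x, y * (W y * v y))
          - x ^ (2 * ℓ + 1) * ∫ y in Ioi x, W y * v y / y ^ (2 * ℓ)))
      ∧ (∀ x, X ≤ x → |v x - 1| ≤ 4 * A / Real.sqrt x) := by
  have hX0 : 0 < X := lt_of_lt_of_le one_pos hX
  have hsX : 1 ≤ Real.sqrt X := by simpa using Real.sqrt_le_sqrt hX
  have hA : 0 ≤ A := nonneg_of_abs_le_div_sqrt hX0 (hWA X le_rfl)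
  have hAX' : A / Real.sqrt X ≤ 1 / 12 := by
    rw [div_le_div_iff₀ (by positivity) (by norm_num)]; linarith
  set c : ℝ := (2 * (ℓ : ℝ) + 1)⁻¹ with hc
  have hc0 : 0 < c := by positivity
  have hc1 : c ≤ 1 := by
    rw [hc]; apply inv_le_one_of_one_le₀; have : (0 : ℝ) ≤ ℓ := Nat.cast_nonneg _; linarith
  -- the tail operator on bounded continuous functions
  have hFc : ∀ w : ℝ →ᵇ ℝ, ContinuousOn (fun y => W y * w y) (Ici X) := fun w =>
    hW.mul w.continuous.continuousOn
  have hFB : ∀ w : ℝ →ᵇ ℝ, ∀ y, X ≤ y → |W y * w y| ≤ A * ‖w‖ / (y ^ 2 * Real.sqrt y) :=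
    fun w y hy => abs_mul_bcf_le hX hWA w hy
  set Top : (ℝ →ᵇ ℝ) → ℝ → ℝ := fun w x =>
    (∫ y in Ioi x, y * (W y * w y)) - x ^ (2 * ℓ + 1) * ∫ y in Ioi x, W y * w y / y ^ (2 * ℓ)
    with hTop
  have hTop_bound : ∀ (w : ℝ →ᵇ ℝ) (x : ℝ), X ≤ x → |Top w x| ≤ 8 / 3 * (A * ‖w‖) / Real.sqrt x :=
    fun w x hx => abs_tailOp_le ℓ hX (hFc w) (hFB w) hx
  have hTop_cont : ∀ w : ℝ →ᵇ ℝ, Continuous fun x => Top w (max x X) := fun w =>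
    continuous_tailOp_max ℓ hX (hFc w) (hFB w)
  -- bound of the clamped operator
  have hTmax : ∀ (w : ℝ →ᵇ ℝ) (x : ℝ), |c * Top w (max x X)| ≤ 2 / 9 * ‖w‖ := by
    intro w x
    have hxX : X ≤ max x X := le_max_right _ _
    have hs : Real.sqrt X ≤ Real.sqrt (max x X) := Real.sqrt_le_sqrt hxX
    have hw0 : 0 ≤ ‖w‖ := norm_nonneg _
    rw [abs_mul, abs_of_pos hc0]
    calc c * |Top w (max x X)| ≤ 1 * (8 / 3 * (A * ‖w‖) / Real.sqrt (max x X)) :=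
          mul_le_mul hc1 (hTop_bound w _ hxX) (abs_nonneg _) zero_le_one
      _ ≤ 8 / 3 * (A * ‖w‖) / Real.sqrt X := by
          rw [one_mul]; exact div_le_div_of_nonneg_left (by positivity) (by positivity) hs
      _ = 8 / 3 * (A / Real.sqrt X) * ‖w‖ := by ring
      _ ≤ 8 / 3 * (1 / 12) * ‖w‖ := by gcongr
      _ = 2 / 9 * ‖w‖ := by ring
  -- the contraction
  set T : (ℝ →ᵇ ℝ) → (ℝ →ᵇ ℝ) := fun w =>
    ofNormedAddCommGroup (fun x => 1 + c * Top w (max x X))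
      (continuous_const.add (continuous_const.mul (hTop_cont w))) (1 + 2 / 9 * ‖w‖)
      (fun x => by
        rw [Real.norm_eq_abs]
        exact (abs_add_le _ _).trans (by rw [abs_one]; linarith [hTmax w x]))
    with hT
  have hT_apply : ∀ (w : ℝ →ᵇ ℝ) (x : ℝ), T w x = 1 + c * Top w (max x X) := fun w x => rfl
  have hLip : ∀ w₁ w₂ : ℝ →ᵇ ℝ, dist (T w₁) (T w₂) ≤ 2 / 9 * dist w₁ w₂ := by
    intro w₁ w₂
    rw [dist_le (by positivity)]
    intro x
    have hxX : X ≤ max x X := le_max_right _ _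
    rw [Real.dist_eq, hT_apply, hT_apply, add_sub_add_left_eq_sub, ← mul_sub]
    have hlin : Top w₁ (max x X) - Top w₂ (max x X) = Top (w₁ - w₂) (max x X) := by
      have h := tailOp_sub ℓ hX (hFc w₁) (hFB w₁) (hFc w₂) (hFB w₂) hxX
      simp only [hTop]
      rw [h]
      congr 1
      · refine integral_congr_ae (Eventually.of_forall fun y => ?_)
        simp only [BoundedContinuousFunction.coe_sub, Pi.sub_apply]; ring
      · congr 1
        refine integral_congr_ae (Eventually.of_forall fun y => ?_)
        simp only [BoundedContinuousFunction.coe_sub, Pi.sub_apply]; ring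
    rw [hlin, dist_eq_norm]
    exact hTmax (w₁ - w₂) x
  have hK : ContractingWith (2 / 9) T := by
    refine ⟨by norm_num, LipschitzWith.of_dist_le_mul fun w₁ w₂ => ?_⟩
    rw [show ((2 / 9 : NNReal) : ℝ) = 2 / 9 by norm_num]
    exact hLip w₁ w₂
  set v₀ : ℝ →ᵇ ℝ := ContractingWith.fixedPoint T hK with hv₀
  have hfix : T v₀ = v₀ := ContractingWith.fixedPoint_isFixedPt hK
  -- a priori bound
  have hnorm : ‖v₀‖ ≤ 9 / 7 := by
    have h1 : ‖v₀‖ ≤ 1 + 2 / 9 * ‖v₀‖ := by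
      rw [norm_le (by positivity)]
      intro x
      have h2 : v₀ x = T v₀ x := by rw [hfix]
      rw [h2, hT_apply, Real.norm_eq_abs]
      exact (abs_add_le _ _).trans (by rw [abs_one]; linarith [hTmax v₀ x])
    linarith
  refine ⟨v₀, v₀.continuous, fun x => ?_, fun x hx => ?_, fun x hx => ?_⟩
  · have := v₀.norm_coe_le_norm x
    rw [Real.norm_eq_abs] at this
    exact this.trans hnorm
  · conv_lhs => rw [← hfix, hT_apply, max_eq_left hx]
  · have hx0 : 0 < x := hX0.trans_le hx
    conv_lhs => rw [← hfix, hT_apply, max_eq_left hx, add_sub_cancel_left]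
    rw [abs_mul, abs_of_pos hc0]
    calc c * |Top v₀ x| ≤ 1 * (8 / 3 * (A * ‖v₀‖) / Real.sqrt x) :=
          mul_le_mul hc1 (hTop_bound v₀ x hx) (abs_nonneg _) zero_le_one
      _ ≤ 8 / 3 * (A * (9 / 7)) / Real.sqrt x := by rw [one_mul]; gcongr
      _ ≤ 4 * A / Real.sqrt x := by
          rw [div_le_div_iff_of_pos_right (Real.sqrt_pos.2 hx0)]; nlinarith

end Recessive

section Derivatives

variable {W : ℝ → ℝ} {X A : ℝ}

/-- `d/dx (x^ℓ)⁻¹ = −ℓ/x^{ℓ+1}` (`x ≠ 0`), without natural subtraction in the exponent. [folklore] -/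
theorem hasDerivAt_pow_inv (ℓ : ℕ) {x : ℝ} (hx : x ≠ 0) :
    HasDerivAt (fun x : ℝ => (x ^ ℓ)⁻¹) (-(ℓ : ℝ) / x ^ (ℓ + 1)) x := by
  rcases Nat.eq_zero_or_pos ℓ with hl | hl
  · subst hl
    simpa using (hasDerivAt_const x (1 : ℝ))
  · obtain ⟨m, rfl⟩ : ∃ m, ℓ = m + 1 := ⟨ℓ - 1, by omega⟩
    have h := (hasDerivAt_pow (m + 1) x).inv (pow_ne_zero _ hx)
    refine h.congr_deriv ?_
    have hxm : x ^ m ≠ 0 := pow_ne_zero _ hx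
    push_cast
    field_simp
    ring

/-- **Differentiating the integral equation.** If a bounded continuous `v` solves
`v(x) = 1 + (2ℓ+1)⁻¹[∫_x^∞ yWv − x^{2ℓ+1}∫_x^∞ Wv/y^{2ℓ}]` on `[X, ∞)` (`W` as above, `|v| ≤ C`),
then with `v'(x) := −x^{2ℓ} ∫_x^∞ W v/y^{2ℓ}`: `v'` is continuous on `[X, ∞)`, `v` has derivative
`v'` and `v'` has derivative `(2ℓ/x) v' + W v` on `(X, ∞)`, and `|v'(x)| ≤ 2AC/(3x√x)`. [folklore] -/
theorem volterra_inverseSquareTail_deriv (ℓ : ℕ) (hX : 1 ≤ X) (hW : ContinuousOn W (Ici X))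
    (hWA : ∀ y, X ≤ y → |W y| ≤ A / (y ^ 2 * Real.sqrt y)) {v : ℝ → ℝ} (hv : Continuous v)
    {C : ℝ} (hvC : ∀ x, |v x| ≤ C)
    (heq : ∀ x, X ≤ x → v x = 1 + (2 * (ℓ : ℝ) + 1)⁻¹ * ((∫ y in Ioi x, y * (W y * v y))
      - x ^ (2 * ℓ + 1) * ∫ y in Ioi x, W y * v y / y ^ (2 * ℓ))) :
    ∃ v' : ℝ → ℝ, (∀ x, v' x = -(x ^ (2 * ℓ) * ∫ y in Ioi x, W y * v y / y ^ (2 * ℓ)))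
    ∧ ContinuousOn v' (Ici X)
    ∧ (∀ x, X < x → HasDerivAt v (v' x) x)
    ∧ (∀ x, X < x → HasDerivAt v' (2 * ℓ / x * v' x + W x * v x) x)
    ∧ (∀ x, X ≤ x → |v' x| ≤ 2 * (A * C) / (3 * (x * Real.sqrt x))) := by
  have hX0 : 0 < X := lt_of_lt_of_le one_pos hX
  have hA : 0 ≤ A := nonneg_of_abs_le_div_sqrt hX0 (hWA X le_rfl)
  have hC : 0 ≤ C := (abs_nonneg _).trans (hvC X)
  -- the integrand `F = W v`
  have hFc : ContinuousOn (fun y => W y * v y) (Ici X) := hW.mul hv.continuousOn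
  have hFB : ∀ y, X ≤ y → |W y * v y| ≤ A * C / (y ^ 2 * Real.sqrt y) := by
    intro y hy
    have hy0 : 0 < y := hX0.trans_le hy
    rw [abs_mul]
    calc |W y| * |v y| ≤ A / (y ^ 2 * Real.sqrt y) * C :=
          mul_le_mul (hWA y hy) (hvC y) (abs_nonneg _) (by positivity)
      _ = A * C / (y ^ 2 * Real.sqrt y) := by ring
  have hc2 : ContinuousOn (fun y => W y * v y / y ^ (2 * ℓ)) (Ici X) :=
    hFc.div (continuousOn_id.pow _) fun y hy => pow_ne_zero _ (hX0.trans_le hy).ne'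
  have hi2 := integrableOn_div_pow_of_sqrtTail hX hFc hFB ℓ le_rfl
  refine ⟨fun x => -(x ^ (2 * ℓ) * ∫ y in Ioi x, W y * v y / y ^ (2 * ℓ)), fun x => rfl, ?_,
    fun x hx => ?_, fun x hx => ?_, fun x hx => ?_⟩
  · exact ((continuousOn_id.pow _).mul (continuousOn_integral_Ioi hc2 hi2)).neg
  · -- derivative of `v` from the integral equation
    have hd := ((hasDerivAt_tailOp ℓ hX hFc hFB hx).const_mul (2 * (ℓ : ℝ) + 1)⁻¹).const_add 1
    have hev : v =ᶠ[𝓝 x] fun x => 1 + (2 * (ℓ : ℝ) + 1)⁻¹ * ((∫ y in Ioi x, y * (W y * v y))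
        - x ^ (2 * ℓ + 1) * ∫ y in Ioi x, W y * v y / y ^ (2 * ℓ)) := by
      filter_upwards [Ioi_mem_nhds hx] with z hz using heq z (le_of_lt hz)
    refine (hd.congr_deriv ?_).congr_of_eventuallyEq hev
    have hn : (2 * (ℓ : ℝ) + 1) ≠ 0 := by positivity
    field_simp
  · have hd := (hasDerivAt_pow_mul_tail ℓ hX hFc hFB hx).neg
    refine hd.congr_deriv ?_
    ring
  · have hx0 : 0 < x := hX0.trans_le hx
    have h2 := abs_integral_div_pow_of_sqrtTail_le hX hFc hFB ℓ hx
    rw [abs_neg, abs_mul, abs_of_pos (pow_pos hx0 _)]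
    calc x ^ (2 * ℓ) * |∫ y in Ioi x, W y * v y / y ^ (2 * ℓ)|
        ≤ x ^ (2 * ℓ) * (2 * (A * C) / ((4 * ℓ + 3) * (x ^ (2 * ℓ + 1) * Real.sqrt x))) :=
          mul_le_mul_of_nonneg_left h2 (pow_pos hx0 _).le
      _ = 2 * (A * C) / ((4 * ℓ + 3) * (x * Real.sqrt x)) := by
          rw [pow_succ]; field_simp
      _ ≤ 2 * (A * C) / (3 * (x * Real.sqrt x)) := by
          apply div_le_div_of_nonneg_left (by positivity) (by positivity)
          have : (0 : ℝ) ≤ 4 * ℓ * (x * Real.sqrt x) := by positivity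
          nlinarith

/-- **The recessive solution of `u'' = (ℓ(ℓ+1)/x² + W) u` at `+∞`.** For `ℓ : ℕ`, `X ≥ 1`, `W`
continuous on `[X, ∞)` with `|W(x)| ≤ A/(x²√x)` and `12A ≤ √X`, there are `u, u'` continuous on
`[X, ∞)` with `u' = du/dx`, `du'/dx = (ℓ(ℓ+1)/x² + W)u` on `(X, ∞)`, and
`|x^ℓ u(x) − 1| ≤ 4A/√x`, `|x^{ℓ+1} u'(x) + ℓ| ≤ (4ℓ+1)A/√x`, `u > 0` on `[X, ∞)`:
`u = x^{-ℓ}(1 + O(x^{-1/2}))` is the unique-up-to-scalars solution decaying like the recessive Euler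
power `x^{-ℓ}`. (Hartman, ODE, Ch. XI §9). [folklore] -/
theorem exists_inverseSquareTail_recessive (ℓ : ℕ) (hX : 1 ≤ X) (hW : ContinuousOn W (Ici X))
    (hWA : ∀ y, X ≤ y → |W y| ≤ A / (y ^ 2 * Real.sqrt y)) (hAX : 12 * A ≤ Real.sqrt X) :
    ∃ u u' : ℝ → ℝ, ContinuousOn u (Ici X) ∧ ContinuousOn u' (Ici X)
      ∧ (∀ x, X < x → HasDerivAt u (u' x) x)
      ∧ (∀ x, X < x → HasDerivAt u' (((ℓ : ℝ) * (ℓ + 1) / x ^ 2 + W x) * u x) x)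
      ∧ (∀ x, X ≤ x → |x ^ ℓ * u x - 1| ≤ 4 * A / Real.sqrt x)
      ∧ (∀ x, X ≤ x → |x ^ (ℓ + 1) * u' x + ℓ| ≤ (4 * ℓ + 1) * A / Real.sqrt x)
      ∧ (∀ x, X ≤ x → 0 < u x) := by
  have hX0 : 0 < X := lt_of_lt_of_le one_pos hX
  have hA : 0 ≤ A := nonneg_of_abs_le_div_sqrt hX0 (hWA X le_rfl)
  obtain ⟨v, hvc, hvb, heq, hv1⟩ := exists_volterra_inverseSquareTail ℓ hX hW hWA hAX
  obtain ⟨v', _, hv'c, hvd, hv'd, hv'b⟩ := volterra_inverseSquareTail_deriv ℓ hX hW hWA hvc hvb heq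
  refine ⟨fun x => v x / x ^ ℓ, fun x => v' x / x ^ ℓ - ℓ * v x / x ^ (ℓ + 1), ?_, ?_,
    fun x hx => ?_, fun x hx => ?_, fun x hx => ?_, fun x hx => ?_, fun x hx => ?_⟩
  · exact hvc.continuousOn.div (continuousOn_id.pow _) fun x hx => pow_ne_zero _ (hX0.trans_le hx).ne'
  · refine (hv'c.div (continuousOn_id.pow _) fun x hx => pow_ne_zero _ (hX0.trans_le hx).ne').sub ?_
    exact (continuousOn_const.mul hvc.continuousOn).div (continuousOn_id.pow _)
      fun x hx => pow_ne_zero _ (hX0.trans_le hx).ne'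
  · -- `u' = du/dx`
    have hx0 : x ≠ 0 := (hX0.trans hx).ne'
    have h := (hvd x hx).mul (hasDerivAt_pow_inv ℓ hx0)
    have e : (fun x => v x / x ^ ℓ) = fun x => v x * (x ^ ℓ)⁻¹ := by
      funext y; rw [div_eq_mul_inv]
    rw [e]
    refine h.congr_deriv ?_
    have hxl : x ^ ℓ ≠ 0 := pow_ne_zero _ hx0
    have hxl1 : x ^ (ℓ + 1) ≠ 0 := pow_ne_zero _ hx0
    field_simp
    ring
  · -- `du'/dx = (ℓ(ℓ+1)/x² + W) u`
    have hx0 : x ≠ 0 := (hX0.trans hx).ne'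
    have hxpos : 0 < x := hX0.trans hx
    have h1 := (hv'd x hx).mul (hasDerivAt_pow_inv ℓ hx0)
    have h2 := ((hvd x hx).mul (hasDerivAt_pow_inv (ℓ + 1) hx0)).const_mul (ℓ : ℝ)
    have h := h1.sub h2
    have e : (fun x => v' x / x ^ ℓ - ℓ * v x / x ^ (ℓ + 1))
        = fun x => v' x * (x ^ ℓ)⁻¹ - ℓ * (v x * (x ^ (ℓ + 1))⁻¹) := by
      funext y; simp only [div_eq_mul_inv]; ring
    rw [e]
    refine h.congr_deriv ?_
    have hxl : x ^ ℓ ≠ 0 := pow_ne_zero _ hx0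
    push_cast
    field_simp
    ring
  · -- `|x^ℓ u − 1| ≤ 4A/√x`
    have hx0 : x ≠ 0 := (hX0.trans_le hx).ne'
    have : x ^ ℓ * (v x / x ^ ℓ) = v x := by field_simp
    rw [this]
    exact hv1 x hx
  · -- `|x^{ℓ+1} u' + ℓ| ≤ (4ℓ+1)A/√x`
    have hxpos : 0 < x := hX0.trans_le hx
    have hx0 : x ≠ 0 := hxpos.ne'
    have hs : 0 < Real.sqrt x := Real.sqrt_pos.2 hxpos
    have e : x ^ (ℓ + 1) * (v' x / x ^ ℓ - ℓ * v x / x ^ (ℓ + 1)) + ℓ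
        = x * v' x - ℓ * (v x - 1) := by
      rw [pow_succ]; field_simp; ring
    rw [e]
    have h1 : |x * v' x| ≤ A / Real.sqrt x := by
      rw [abs_mul, abs_of_pos hxpos]
      calc x * |v' x| ≤ x * (2 * (A * (9 / 7)) / (3 * (x * Real.sqrt x))) :=
            mul_le_mul_of_nonneg_left (hv'b x hx) hxpos.le
        _ = (6 / 7) * A / Real.sqrt x := by field_simp; ring
        _ ≤ A / Real.sqrt x := by
            rw [div_le_div_iff_of_pos_right hs]; nlinarith
    have h2 : |(ℓ : ℝ) * (v x - 1)| ≤ ℓ * (4 * A / Real.sqrt x) := by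
      rw [abs_mul, Nat.abs_cast]
      exact mul_le_mul_of_nonneg_left (hv1 x hx) (Nat.cast_nonneg _)
    calc |x * v' x - ℓ * (v x - 1)| ≤ |x * v' x| + |(ℓ : ℝ) * (v x - 1)| := abs_sub _ _
      _ ≤ A / Real.sqrt x + ℓ * (4 * A / Real.sqrt x) := add_le_add h1 h2
      _ = (4 * ℓ + 1) * A / Real.sqrt x := by ring
  · -- positivity
    have hxpos : 0 < x := hX0.trans_le hx
    have hs : 0 < Real.sqrt x := Real.sqrt_pos.2 hxpos
    have hsX : Real.sqrt X ≤ Real.sqrt x := Real.sqrt_le_sqrt hx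
    have h4 : 4 * A / Real.sqrt x ≤ 1 / 3 := by
      rw [div_le_div_iff₀ hs (by norm_num)]; nlinarith
    have hv23 : 2 / 3 ≤ v x := by
      have := hv1 x hx
      have := (abs_le.1 (this.trans h4)).1
      linarith
    exact div_pos (by linarith) (pow_pos hxpos _)

end Derivatives

end Literature.Analysis.ODE
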